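import Literature.Analysis.FunctionSpaces.SobolevBallScaling
import HarnessLib

/-!
# Decay at infinity of planar Sobolev functions with finite Dirichlet energy — letters

Helper (def-free) for ROAD (W) of crux `stmt-QuantumFields-23533` (S1″ / the (GAP) socket), memo `ROAD-W-WENTE-3PI-w3g16.md`
§2 (W-ONE) (d) and the located seam of 2026-08-29 17:05Z («the decay row must be the GENERAL one, for the partners `a b`
too»): the decay row consumed by the removable-pole step of brick W-INV.  For EVERY `v ∈ W^{1,1}_loc(ℝ²)` with `v ∈ L²_loc`
and `∇v ∈ L²(ℝ²)` — no equation, no bounded means —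

  `∫_{‖x − c‖ > 1} v(x)² / ‖x − c‖⁴ dx < ∞`       (`integrableOn_sq_div_norm_pow_four`, in the sibling file
`PoincareLipschitzSobolevPlanarDecay`; this file holds the letters §1–§2 and the series/weight/Riesz lemmas).

Route (dyadic Poincaré):
* §1 (P) the SCALE-INVARIANT `L^p` POINCARÉ–WIRTINGER INEQUALITY ON BALLS `‖f − ⨍_B f‖_{L^p(B)} ≤ C·r·‖g‖_{L^p(B)}` on every
  ball `B = B(x₀, r)` of a finite-dimensional real inner-product space (unit ball: the tree's `poincare_wirtinger_holds`;
  transport by `x = x₀ + r y` with the letters of `SobolevBallScaling` — the same route as `exists_eLpNorm_sub_average_le_ball`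
  there, without the Sobolev step, which needs `p < n` and is unavailable at `p = n = 2`);
* §2 (M) on the dyadic balls `B_k = B(c, 2^k)` the means `m_k = ⨍_{B_k} v` satisfy `|m_k − m_{k+1}|·|B_k|^{1/2} ≤ 3C·2^k·‖∇v‖₂`,
  hence grow at most linearly in `k`, and `‖v‖_{L²(B_{k+1})} ≤ 2^{k+1}·(k + 2)·T` with a finite constant `T`;
* §3 (S) on the annulus `A_k = {2^k ≤ ‖x − c‖ < 2^{k+1}}` the weight is `≤ 16^{−k}`, so `∫_{A_k} v²/‖x−c‖⁴ ≤ 4·4^{−k}(k+2)²T²`,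
  and `Σ_k (k+2)² 4^{−k} < ∞`.

HONEST: plane Sobolev bookkeeping; proves nothing of (ONE′)/(W-OSC)/(F′)/(GAP)/(TM)/S1″/`BlockLipschitzL`/`HistoryTailL`;
rung R3 = YM₃ on T³ — NOT d = 4, NOT infinite volume, NOT a mass gap, NOT Clay.
-/

set_option autoImplicit false

noncomputable section

namespace Summit.QuantumFields.YangMills.Theorems.PoincareLipschitzSobolevPlanarDecay

open MeasureTheory Set Function Filter TopologicalSpace Metric Module
open Literature.Analysis.FunctionSpaces
open scoped NNReal ENNReal Topology

/-! ## §1 (P) The scale-invariant Poincaré–Wirtinger inequality on balls -/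

section Poincare

variable {E : Type*} [NormedAddCommGroup E] [InnerProductSpace ℝ E] [FiniteDimensional ℝ E]
  [MeasurableSpace E] [BorelSpace E]
variable {F : Type*} [NormedAddCommGroup F] [NormedSpace ℝ F]

/-- **Poincaré–Wirtinger on balls, scale-invariant form.**  For `1 ≤ p` and a complete codomain there is `C = C(E, p)`
such that for every ball `B = B(x₀, r)`, `r > 0`, every `f ∈ W^{1,p}(B; F)` and every weak derivative `g` of `f` on `B`,
`‖f − ⨍_B f‖_{L^p(B)} ≤ C · r · ‖g‖_{L^p(B)}`.  Unit ball: the tree's Poincaré–Wirtinger inequality on the bounded connected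
Lipschitz domain `B(0,1)`; general ball by the change of variables `x = x₀ + r y` (the mean is invariant,
`‖F ∘ A‖_{L^p(B₁)} = r^{−n/p}‖F‖_{L^p(B)}`, `D(f ∘ A) = r·(Df) ∘ A`). [cite: Evans2010, §5.8.1 Theorem 1] -/
theorem exists_eLpNorm_sub_average_le_mul_radius [CompleteSpace F] {p : ℝ≥0} (hp : 1 ≤ p) :
    ∃ C : ℝ≥0, ∀ (x₀ : E) (r : ℝ), 0 < r → ∀ (f : E → F) (g : E → E →L[ℝ] F),
      MemSobolevDomain 1 (p : ℝ≥0∞) (⟨ball x₀ r, isOpen_ball⟩ : Opens E) volume f →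
      HasWeakFDerivOn (⟨ball x₀ r, isOpen_ball⟩ : Opens E) volume f g →
      eLpNorm (fun x => f x - ⨍ y in ball x₀ r, f y) p (volume.restrict (ball x₀ r)) ≤
        C * ENNReal.ofReal r * eLpNorm g p (volume.restrict (ball x₀ r)) := by
  set n := finrank ℝ E with hn
  set B₁ : Opens E := ⟨ball (0 : E) 1, isOpen_ball⟩ with hB₁
  have hB₁c : IsConnected (B₁ : Set E) :=
    ⟨⟨0, mem_ball_self one_pos⟩, (convex_ball (0 : E) 1).isPreconnected⟩
  have hp1 : (1 : ℝ≥0∞) ≤ (p : ℝ≥0∞) := by exact_mod_cast hp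
  obtain ⟨CP, hCP⟩ := poincare_wirtinger_holds (E' := E) (F := F) (isLipschitzDomain_ball (0 : E) 1)
    isBounded_ball hB₁c (p : ℝ≥0∞) hp1 volume
  refine ⟨CP, fun x₀ r hr f g hf hg => ?_⟩
  set a : ℝ := (n : ℝ) * (p : ℝ)⁻¹ with ha
  set R : ℝ≥0∞ := ENNReal.ofReal r with hR
  have hR0 : R ≠ 0 := (ENNReal.ofReal_pos.2 hr).ne'
  have hRt : R ≠ ⊤ := ENNReal.ofReal_ne_top
  -- transport to the unit ball
  set B : Opens E := ⟨ball x₀ r, isOpen_ball⟩ with hB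
  have hpre : affinePreimage r x₀ B = B₁ := affinePreimage_ball hr x₀
  have hpreS : (fun y : E => x₀ + r • y) ⁻¹' ball x₀ r = ball (0 : E) 1 := by
    rw [Literature.Analysis.FluidPDE.space_affine_preimage_ball hr, sub_self, smul_zero, div_self hr.ne']
  set f₁ : E → F := fun y => f (x₀ + r • y) with hf₁def
  set g₁ : E → E →L[ℝ] F := fun y => r • g (x₀ + r • y) with hg₁def
  have hf₁ : MemSobolevDomain 1 (p : ℝ≥0∞) B₁ volume f₁ := hpre ▸ hf.comp_affine_one hr x₀
  have hg₁ : HasWeakFDerivOn B₁ volume f₁ g₁ := hpre ▸ hg.comp_affine hr x₀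
  -- the mean and the centred function
  set m : F := ⨍ y in ball x₀ r, f y with hm
  have hmean : ⨍ y in (B₁ : Set E), f₁ y = m := by
    change ⨍ y in ball (0 : E) 1, f (x₀ + r • y) = m
    rw [← hpreS, setAverage_preimage_comp_affine hr x₀ f (ball x₀ r)]
  set F₁ : E → F := fun y => f₁ y - m with hF₁
  -- the unit-ball inequality
  have hunit : eLpNorm F₁ p (volume.restrict (ball (0 : E) 1)) ≤
      CP * eLpNorm g₁ p (volume.restrict (ball (0 : E) 1)) := by
    have := hCP f₁ g₁ hf₁ hg₁
    rwa [hmean] at this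
  -- the norms
  have e1 : eLpNorm F₁ p (volume.restrict (ball (0 : E) 1)) =
      R ^ (-a) * eLpNorm (fun x => f x - m) p (volume.restrict (ball x₀ r)) := by
    rw [show F₁ = fun y => (fun x => f x - m) (x₀ + r • y) from rfl, ← hpreS,
      eLpNorm_comp_affine hr x₀ (fun x => f x - m) p (ball x₀ r), ofReal_inv_pow_rpow hr n p,
      ha, neg_mul]
  have e3 : eLpNorm g₁ p (volume.restrict (ball (0 : E) 1)) =
      R * (R ^ (-a) * eLpNorm g p (volume.restrict (ball x₀ r))) := by
    have hsm := eLpNorm_const_smul r (fun y => g (x₀ + r • y)) (p : ℝ≥0∞)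
      (volume.restrict (ball (0 : E) 1))
    rw [show (r • fun y => g (x₀ + r • y)) = g₁ from rfl] at hsm
    rw [hsm, Real.enorm_eq_ofReal hr.le, ← hpreS,
      eLpNorm_comp_affine hr x₀ g p (ball x₀ r), ofReal_inv_pow_rpow hr n p, ha, neg_mul]
  rw [e1, e3] at hunit
  set X := eLpNorm (fun x => f x - m) p (volume.restrict (ball x₀ r))
  set Z := eLpNorm g p (volume.restrict (ball x₀ r))
  have h2 : R ^ a * R ^ (-a) = 1 := by
    rw [← ENNReal.rpow_add _ _ hR0 hRt, add_neg_cancel, ENNReal.rpow_zero]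
  calc X = R ^ a * (R ^ (-a) * X) := by rw [← mul_assoc, h2, one_mul]
    _ ≤ R ^ a * (CP * (R * (R ^ (-a) * Z))) := mul_le_mul_of_nonneg_left hunit (by positivity)
    _ = CP * R * (R ^ a * R ^ (-a)) * Z := by ring
    _ = CP * R * Z := by rw [h2, mul_one]

end Poincare

/-! ## §2 Letters on the plane: volumes of balls, constants in `L²`, the `L²` norm as a lower integral -/

section Plane

/-- The plane is two-dimensional. [folklore] -/
theorem finrank_plane : finrank ℝ (EuclideanSpace ℝ (Fin 2)) = 2 := finrank_euclideanSpace_fin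

/-- Doubling the radius quadruples the area of a planar ball. [folklore] -/
theorem volume_ball_two_mul (c : EuclideanSpace ℝ (Fin 2)) {r : ℝ} (hr : 0 ≤ r) :
    volume (ball c (2 * r)) = 4 * volume (ball c r) := by
  rw [Measure.addHaar_ball volume c hr, Measure.addHaar_ball volume c (by positivity : 0 ≤ 2 * r),
    finrank_plane, ← mul_assoc]
  congr 1
  rw [show (2 * r) ^ 2 = 4 * r ^ 2 by ring, ENNReal.ofReal_mul (by norm_num), ENNReal.ofReal_ofNat]

/-- Square roots of areas: `|B(c,2r)|^{1/2} = 2 |B(c,r)|^{1/2}`. [folklore] -/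
theorem sqrt_volume_ball_two_mul (c : EuclideanSpace ℝ (Fin 2)) {r : ℝ} (hr : 0 ≤ r) :
    volume (ball c (2 * r)) ^ (1 / 2 : ℝ) = 2 * volume (ball c r) ^ (1 / 2 : ℝ) := by
  rw [volume_ball_two_mul c hr, ENNReal.mul_rpow_of_nonneg _ _ (by norm_num : (0 : ℝ) ≤ 1 / 2)]
  congr 1
  rw [show (4 : ℝ≥0∞) = 2 ^ (2 : ℝ) by rw [ENNReal.rpow_two]; norm_num, ← ENNReal.rpow_mul]
  norm_num

/-- The area of the unit planar ball is positive and finite, and so is its square root. [folklore] -/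
theorem sqrt_volume_ball_one_ne (c : EuclideanSpace ℝ (Fin 2)) :
    volume (ball c 1) ^ (1 / 2 : ℝ) ≠ 0 ∧ volume (ball c 1) ^ (1 / 2 : ℝ) ≠ ⊤ := by
  have h0 : volume (ball c 1) ≠ 0 := (measure_ball_pos volume c one_pos).ne'
  have ht : volume (ball c 1) ≠ ⊤ := measure_ball_lt_top.ne
  constructor
  · intro h
    rw [ENNReal.rpow_eq_zero_iff] at h
    rcases h with ⟨h1, _⟩ | ⟨_, h2⟩
    · exact h0 h1
    · norm_num at h2
  · intro h
    rw [ENNReal.rpow_eq_top_iff] at h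
    rcases h with ⟨_, h2⟩ | ⟨h1, _⟩
    · norm_num at h2
    · exact ht h1

/-- Square roots of areas of dyadic balls: `|B(c,2^k)|^{1/2} = 2^k |B(c,1)|^{1/2}`. [folklore] -/
theorem sqrt_volume_ball_two_pow (c : EuclideanSpace ℝ (Fin 2)) (k : ℕ) :
    volume (ball c (2 ^ k)) ^ (1 / 2 : ℝ) = 2 ^ k * volume (ball c 1) ^ (1 / 2 : ℝ) := by
  induction k with
  | zero => simp
  | succ j ih =>
    rw [pow_succ, mul_comm ((2 : ℝ) ^ j) 2, sqrt_volume_ball_two_mul c (by positivity), ih, pow_succ]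
    ring

/-- The `L²(B)` norm of a constant: `‖a‖ · |B|^{1/2}`. [folklore] -/
theorem eLpNorm_const_two_ball (a : ℝ) (c : EuclideanSpace ℝ (Fin 2)) {r : ℝ} (hr : 0 < r) :
    eLpNorm (fun _ : EuclideanSpace ℝ (Fin 2) => a) 2 (volume.restrict (ball c r))
      = ‖a‖ₑ * volume (ball c r) ^ (1 / 2 : ℝ) := by
  have hμ : volume.restrict (ball c r) ≠ 0 := by
    intro h
    have := (measure_ball_pos (volume : Measure (EuclideanSpace ℝ (Fin 2))) c hr).ne'
    apply this
    have h2 : volume.restrict (ball c r) (ball c r) = 0 := by rw [h]; rfl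
    rwa [Measure.restrict_apply_self] at h2
  rw [eLpNorm_const a two_ne_zero hμ, Measure.restrict_apply_univ]
  norm_num

/-- The square of the `L²` norm is the lower integral of `‖f‖²`. [folklore] -/
theorem eLpNorm_two_sq_eq_lintegral {α : Type*} [MeasurableSpace α] (μ : Measure α) (f : α → ℝ) :
    eLpNorm f 2 μ ^ 2 = ∫⁻ x, ‖f x‖ₑ ^ 2 ∂μ := by
  rw [eLpNorm_eq_lintegral_rpow_enorm_toReal two_ne_zero ENNReal.ofNat_ne_top]
  simp only [ENNReal.toReal_ofNat, one_div, ENNReal.rpow_two]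
  rw [← ENNReal.rpow_two, ← ENNReal.rpow_mul, show (2 : ℝ)⁻¹ * 2 = 1 by norm_num, ENNReal.rpow_one]

end Plane

section Series

/-! ### The summable comparison series and the weight on dyadic annuli -/

/-- The comparison series `Σ_k (k+2)² 4^{−k}` converges (in `ℝ≥0∞`: its sum is not `⊤`). [folklore] -/
theorem tsum_sq_mul_geometric_ne_top :
    (∑' k : ℕ, ((k : ℝ≥0∞) + 2) ^ 2 * (4 : ℝ≥0∞)⁻¹ ^ k) ≠ ⊤ := by
  have hr : ‖(4 : ℝ)⁻¹‖ < 1 := by rw [Real.norm_eq_abs, abs_of_pos (by norm_num)]; norm_num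
  have h2 := summable_pow_mul_geometric_of_norm_lt_one 2 hr
  have h1 := summable_pow_mul_geometric_of_norm_lt_one 1 hr
  have h0 := summable_pow_mul_geometric_of_norm_lt_one 0 hr
  have hreal : Summable (fun k : ℕ => ((k : ℝ) + 2) ^ 2 * (4 : ℝ)⁻¹ ^ k) := by
    have := (h2.add (h1.mul_left 4)).add (h0.mul_left 4)
    refine this.congr (fun k => ?_)
    simp only [pow_one, pow_zero, one_mul]
    ring
  have hnn : Summable (fun k : ℕ => ((k : ℝ≥0) + 2) ^ 2 * (4 : ℝ≥0)⁻¹ ^ k) := by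
    rw [← NNReal.summable_coe]
    refine hreal.congr (fun k => ?_)
    push_cast
    ring
  have hcoe : ∀ k : ℕ, (((((k : ℝ≥0) + 2) ^ 2 * (4 : ℝ≥0)⁻¹ ^ k : ℝ≥0)) : ℝ≥0∞)
      = ((k : ℝ≥0∞) + 2) ^ 2 * (4 : ℝ≥0∞)⁻¹ ^ k := by
    intro k
    rw [ENNReal.coe_mul, ENNReal.coe_pow, ENNReal.coe_pow, ENNReal.coe_inv (by norm_num),
      ENNReal.coe_add, ENNReal.coe_natCast, ENNReal.coe_ofNat, ENNReal.coe_ofNat]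
  have := ENNReal.tsum_coe_ne_top_iff_summable.2 hnn
  simpa only [hcoe] using this

/-- Powers of two: `(2^{k+1})² = 4·4^k` in `ℝ≥0∞`. [folklore] -/
theorem two_pow_succ_sq (k : ℕ) : ((2 : ℝ≥0∞) ^ (k + 1)) ^ 2 = 4 * 4 ^ k := by
  rw [← pow_mul, Nat.mul_comm (k + 1) 2, pow_mul, pow_succ']
  norm_num

/-- The annular weight in `ℝ≥0∞`: `ofReal((4⁻¹)^k)² · 4^k = (4⁻¹)^k`. [folklore] -/
theorem ofReal_weight_mul_four_pow (k : ℕ) :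
    ENNReal.ofReal (((4 : ℝ)⁻¹ ^ k) ^ 2) * 4 ^ k = (4 : ℝ≥0∞)⁻¹ ^ k := by
  rw [ENNReal.ofReal_pow (by positivity), ENNReal.ofReal_pow (by positivity),
    ENNReal.ofReal_inv_of_pos (by norm_num : (0 : ℝ) < 4), ENNReal.ofReal_ofNat, sq, mul_assoc,
    ← mul_pow, ENNReal.inv_mul_cancel (by norm_num) (by norm_num), one_pow, mul_one]

/-- On the dyadic annulus `2^k ≤ ‖x − c‖` the weight `‖x−c‖⁻⁴` is at most `((4⁻¹)^k)²`. [folklore] -/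
theorem weight_le_of_le_norm {c x : EuclideanSpace ℝ (Fin 2)} {k : ℕ} (hx : (2 : ℝ) ^ k ≤ ‖x - c‖) :
    ((‖x - c‖ ^ 2)⁻¹) ^ 2 ≤ ((4 : ℝ)⁻¹ ^ k) ^ 2 := by
  have h4 : (0 : ℝ) < 4 ^ k := by positivity
  have hsq : (4 : ℝ) ^ k ≤ ‖x - c‖ ^ 2 := by
    rw [show (4 : ℝ) ^ k = (2 ^ k) ^ 2 by rw [← pow_mul, mul_comm, pow_mul]; norm_num]
    exact pow_le_pow_left₀ (by positivity) hx 2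
  have hinv : (‖x - c‖ ^ 2)⁻¹ ≤ (4 : ℝ)⁻¹ ^ k := by
    rw [inv_pow]
    exact inv_anti₀ h4 hsq
  exact pow_le_pow_left₀ (by positivity) hinv 2

/-- For a functional on the plane, the operator norm is the Euclidean norm of its values on the standard basis:
`‖L‖² = Σ_k (L e_k)²` (Riesz). [folklore] -/
theorem opNorm_sq_eq_sum_sq (L : EuclideanSpace ℝ (Fin 2) →L[ℝ] ℝ) :
    ‖L‖ ^ 2 = ∑ k : Fin 2, (L (EuclideanSpace.single k (1 : ℝ))) ^ 2 := by
  set w : EuclideanSpace ℝ (Fin 2) := (InnerProductSpace.toDual ℝ (EuclideanSpace ℝ (Fin 2))).symm L with hw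
  have hL : ‖L‖ = ‖w‖ := by rw [hw, LinearIsometryEquiv.norm_map]
  have hk : ∀ k : Fin 2, w k = L (EuclideanSpace.single k (1 : ℝ)) := by
    intro k
    have h1 : inner ℝ w (EuclideanSpace.single k (1 : ℝ)) = L (EuclideanSpace.single k (1 : ℝ)) := by
      rw [hw, InnerProductSpace.toDual_symm_apply]
    rw [EuclideanSpace.inner_single_right] at h1
    simpa using h1
  rw [hL, EuclideanSpace.norm_sq_eq]
  refine Finset.sum_congr rfl (fun k _ => ?_)
  rw [hk k, Real.norm_eq_abs, sq_abs]

end Series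

end Summit.QuantumFields.YangMills.Theorems.PoincareLipschitzSobolevPlanarDecay

end
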